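import Summits.BirchSwinnertonDyer.Rank1Residual.X2.GreenbergVatsalAnalyticTransferCore
import Summits.BirchSwinnertonDyer.Rank1Residual.X2.ResidualDevissageMultiplicative
import HarnessLib

/-!
# Class X2a (odd multiplicative Eisenstein prime, GV case 1): the ASSEMBLY STEP of Greenberg–Vatsal's
# Thm. (1.3) at `p ‖ N` — from the kernel devissage count, two character-theoretic numbers and ONE
# analytic statement about the NON-PRIMITIVE `p`-adic `L`-function to the `λ`/`μ^anal` clause of the
# flag's named fact (cell `b2b-bsdres`, unit `b2b-bsdres-eisenstein-p2`, gen 17; part 2 of 2)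

HONEST FRAMING (run/shared/lean/b2b/bsd-rank1-residual/, verbatim in every file): the goal of the
cell is to DELETE the COMBINATION-SHAPED residual classes of the Birch–Swinnerton-Dyer formula for
ALL analytic-rank `≤ 1` elliptic curves over `ℚ` — "full BSD formula for every rank `≤ 1` curve in
class `C`" assembled STRICTLY from published theorems — so that the rank-`≤ 1` remainder becomes
exactly the CONSTRUCTION-SHAPED classes, which are TYPED (missing-input `Prop`s), NOT attempted.
This is not "finishing BSD". Research route; NO CLAIM BEYOND STATED CLASSES; nothing here changes
a label (X2a stays "CLOSED PUB* modulo `GV00-mult-asserted`" until the referee rules). THEOREMS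
ONLY (no `def`, no named fact, no `sorry`); the two printed inputs not yet in the tree enter as
DISPLAYED HYPOTHESES (numbers `lφ`, `lψ` and one equation), never as assertions.

WHAT (X2-GAP §21.6 (iv)). The flag's exact content is the named fact
`GreenbergVatsal2000.lambda_muAnal_multiplicative_of_gvPar`: at an odd multiplicative Eisenstein
prime under (GV), for every `b ∈ Λ` with `ι b = ϖ · L(E/ℚ, T)`: `b` has unit content (`μ^anal = 0`)
and `ord_T(b mod p) = ord_T(T^e · f_E mod p)` (`λ^anal = λ^alg + e`, `e = 1` split / `0` non-split).
Greenberg–Vatsal's proof of Thm. (1.3) obtains this from THREE equalities with the same right-hand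
side `λ_{φ,Σ₀} + λ_{ψ,Σ₀}`:
(A) `λ^alg_{E,Σ₀} (+ e) = λ_{φ,Σ₀} + λ_{ψ,Σ₀}` — display (16), the devissage; at `p ‖ N` a KERNEL
    THEOREM of gen 16 in the form
    `#H¹(ℚ_Σ/ℚ_∞, Φ₀) · #S^{Σ₀}_{E[p]/Φ₀}(ℚ_∞) = p^{λ(X) + Σ_{ℓ∈Σ₀} δ_E^{(ℓ)} + e}`
    (`ResidualDevissageMultiplicative.natCard_line_mul_quotSelmer_eq_of_{not_,}split`);
(B) `#H¹(ℚ_Σ/ℚ_∞, Φ₀) = p^{λ_{φ,Σ₀}}`, `#S^{Σ₀}_Ψ(ℚ_∞) = p^{λ_{ψ,Σ₀}}` — pp. 29–30, character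
    theory (Iwasawa 1973, Ferrero–Washington, Mazur–Wiles): PRINTED, `E`-independent; here the
    hypotheses `hφ`, `hψ` with abstract exponents `lφ lψ : ℕ`;
(C) `μ(L_{Σ₀}(E/ℚ,T)·ϖ) = 0`, `λ(L_{Σ₀}(E/ℚ,T)·ϖ) = λ_{φ,Σ₀} + λ_{ψ,Σ₀}` — Thm. (3.11) (whose proof
    PRINTS the `p ∣ M` paragraph, p. 43) with (26)–(28): PRINTED; here the hypothesis `hbS` on the
    element `b^{Σ₀} = b · ∏_{ℓ∈Σ₀} 𝒫_ℓ(T) ∈ Λ` (`ι b^{Σ₀} = ϖ · L_{Σ₀}`,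
    `GreenbergVatsal2000.iwasawaToPowerSeries_mul_eulerFactorProduct`);
and (D) display (9), `λ(b^{Σ₀}) = λ(b) + Σδ`, `μ(b^{Σ₀}) = μ(b)` — a KERNEL THEOREM of gen 17
(`EulerFactorInvariants.order_map_toZMod_mul_eulerFactorProduct`, `hasUnitContent_mul_iff`).
THIS FILE performs the assembly `(A) + (B) + (C) + (D) ⟹` the flag's clause, in the kernel:

* (part 1, `X2/GreenbergVatsalAnalyticTransferCore.lean`: the dictionary `λ(X) = ord_T(f_E mod p)`
  for `μ(X) = 0` and the cancellation core `unitContent_and_order_eq_of_order_nonPrimitive_eq`.)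
* §1 **`add_eq_lambdaInvariant_add_of_counts_of_split` / `_of_not_split`**: (A) + (B) ⟹
  `lφ + lψ = λ(X) + Σ_{ℓ∈Σ₀} δ_E^{(ℓ)} + e` (numbers).
* §2 **`unitContent_and_order_eq_of_counts_of_split` / `_of_not_split`**: (A)+(B)+(C)+(D) ⟹
  `HasUnitContent b ∧ ord_T(b mod p) = ord_T(T^e f_E mod p)` — LITERALLY the inner clause of
  `lambda_muAnal_multiplicative_of_gvPar` (split: `PowerSeries.X * fE`; non-split: `fE`); and the
  ONE-HYPOTHESIS forms **`unitContent_and_order_eq_of_card_eq_of_split` / `_of_not_split`** where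
  (B)+(C) are merged into the single printed statement `μ(b^{Σ₀}) = 0`,
  `p^{ord_T(b^{Σ₀} mod p)} = #H¹(ℚ_Σ/ℚ_∞, Φ₀) · #S^{Σ₀}_{E[p]/Φ₀}(ℚ_∞)` (GV p. 43: "the `λ`-invariant of
  `L(G, T)` is equal to `λ_{φ,Σ₀} + λ_{ψ,Σ₀}`. The two terms are the `O`-coranks of `S^{Σ₀}_C(ℚ_∞)`
  and `S^{Σ₀}_D(ℚ_∞)`" + pp. 28–29, Props. (2.6)/(2.8): those coranks are the residual dimensions).

So, granted the cell's registered facts on the algebraic side (A40/A41 Tate uniformisation, A133,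
A135, A137) and the lifting property `H²(ℚ_Σ/ℚ_∞, Φ) = 0`, the X2a flag in GV's CASE 1 (rational
line ramified at `p` and even) reduces to EXACTLY two printed, `E`-independent-in-form statements:
(B) and (C) with the SAME exponents — which is the shape the successor's Literature reading-facts
must have (X2-GAP §22.3). Case 2 of (GV) (line unramified and odd) is NOT treated here (GV: "similar";
or via the `p`-isogenous curve).

References: [GreenbergVatsal2000] §1 (8)–(9), Thm. (1.5); §2 (16), pp. 28–30; §3 Thm. (3.11),
(26)–(28); HOME/b2b-bsdres-eisenstein-p2/X2-GAP.md §22.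
-/

set_option autoImplicit false

noncomputable section

open scoped Classical AddSubgroup

open PowerSeries NumberField IsDedekindDomain Field WeierstrassCurve
  Literature.NumberTheory.EllipticCurves Literature.NumberTheory.EllipticCurves.GreenbergVatsal2000
  Literature.NumberTheory.EllipticCurves.Rank1Residual
  Summit.BirchSwinnertonDyer.Rank1Residual.X2.EulerFactorAlgebra
  Summit.BirchSwinnertonDyer.Rank1Residual.X2.EulerFactorInvariants
  Summit.BirchSwinnertonDyer.Rank1Residual.X2.GreenbergVatsalAnalyticTransferCore
  Summit.BirchSwinnertonDyer.Rank1Residual.X2.ResidualDevissageMultiplicative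

namespace Summit.BirchSwinnertonDyer.Rank1Residual.X2.GreenbergVatsalAnalyticTransfer

/-! ## §1. (A) + (B): `λ_{φ,Σ₀} + λ_{ψ,Σ₀} = λ(X) + Σ_{ℓ∈Σ₀} δ_E^{(ℓ)} + e` as numbers -/

section Counts

variable (W : WeierstrassCurve ℚ) [W.IsGloballyMinimal] [W.IsElliptic] (p : ℕ) [hp : Fact p.Prime]
  (κ : ZpExtension ℚ p) {γ : absoluteGaloisGroup ℚ} (S₀ : Finset (HeightOneSpectrum (𝓞 ℚ)))
  {Φ₀ : AddSubgroup (W.geomTorsion (p : ℤ))} (hΦ : IsRationalLine W p Φ₀)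

/-- **SPLIT `p ‖ N`: `lφ + lψ = λ(X) + Σδ + 1`** from the gen-16 devissage count (A) and the two
character-theoretic cardinalities (B) — the exponents of `#H¹(ℚ_Σ/ℚ_∞, Φ₀)` and
`#S^{Σ₀}_{E[p]/Φ₀}(ℚ_∞)` (GV pp. 29–30: `λ_{φ,Σ₀}`, `λ_{ψ,Σ₀}`), entered as HYPOTHESES. -/
theorem add_eq_lambdaInvariant_add_of_counts_of_split
    (hT : Silverman1994_thmV53_tateUniformisation.{0})
    (hT' : Silverman1994_thmV53_corV54_tateUniformisation.{0})
    (hA : lambda_nonPrimitive_eq_add_sum_delta_multiplicative)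
    (hB : datumSelmer_divisible_of_finite_torsionBy)
    (hF : datumStrictSelmer_lt_datumSelmer_of_split)
    (hκ : κ.IsCyclotomic) (hγ : κ.IsTopGenerator γ) (hp2 : p ≠ 2)
    (hsplit : W.HasSplitMultiplicativeReductionAtPrime p)
    (hS₀ : ∀ v ∈ S₀, ((p : ℕ) : 𝓞 ℚ) ∉ v.asIdeal)
    (hS : ∀ v : HeightOneSpectrum (𝓞 ℚ), v ∉ S₀ → ((p : ℕ) : 𝓞 ℚ) ∉ v.asIdeal →
      W.HasGoodReductionAt v)
    (D : W.SelmerDualData κ γ) [Module.Finite (IwasawaAlgebra p) D.X] (hX : D.IsTorsion)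
    (hμ : D.mu = 0) (hram : ¬ LineUnramifiedAt W p Φ₀) (heven : LineEven W p Φ₀)
    (hlift : ∀ s ∈ ResidualDevissageSelmer.quotSelmer κ.kerSubgroup
        (ResidualDevissageLine.lineSub Φ₀ hΦ).Quot p (↑S₀ : Set (HeightOneSpectrum (𝓞 ℚ))),
      ∃ x ∈ GreenbergVatsal2000.unramifiedOutside κ.kerSubgroup
          ↥((↥(W.geomPrimaryTorsion p))[(p : ℤ)]) p (↑S₀ : Set (HeightOneSpectrum (𝓞 ℚ))),
        ResidualDevissageSelmer.subH1 κ.kerSubgroup (ResidualDevissageLine.lineSub Φ₀ hΦ).proj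
          (ResidualDevissageLine.lineSub Φ₀ hΦ).proj_smul x = s)
    {lφ lψ : ℕ}
    (hφ : Nat.card (GreenbergVatsal2000.unramifiedOutside κ.kerSubgroup
        (ResidualDevissageLine.lineSub Φ₀ hΦ).Sub p (↑S₀ : Set (HeightOneSpectrum (𝓞 ℚ)))) = p ^ lφ)
    (hψ : Nat.card (ResidualDevissageSelmer.quotSelmer κ.kerSubgroup
        (ResidualDevissageLine.lineSub Φ₀ hΦ).Quot p (↑S₀ : Set (HeightOneSpectrum (𝓞 ℚ)))) = p ^ lψ) :
    lφ + lψ = lambdaInvariant p D.X + ∑ v ∈ S₀, delta W p v + 1 := by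
  have h := natCard_line_mul_quotSelmer_eq_of_split W p κ S₀ hΦ hT hT' hA hB hF hκ hγ hp2 hsplit hS₀
    hS D hX hμ hram heven hlift
  rw [hφ, hψ, ← pow_add] at h
  exact pow_right_injective_prime h

/-- **NON-SPLIT `p ‖ N`: `lφ + lψ = λ(X) + Σδ`** from (A) and (B). -/
theorem add_eq_lambdaInvariant_add_of_counts_of_not_split
    (hT : Silverman1994_thmV53_corV54_tateUniformisation.{0})
    (hA : lambda_nonPrimitive_eq_add_sum_delta_multiplicative)
    (hB : datumSelmer_divisible_of_finite_torsionBy)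
    (hκ : κ.IsCyclotomic) (hγ : κ.IsTopGenerator γ) (hp2 : p ≠ 2)
    (hmult : W.HasMultiplicativeReductionAtPrime p) (hns : ¬ W.HasSplitMultiplicativeReductionAtPrime p)
    (hS₀ : ∀ v ∈ S₀, ((p : ℕ) : 𝓞 ℚ) ∉ v.asIdeal)
    (hS : ∀ v : HeightOneSpectrum (𝓞 ℚ), v ∉ S₀ → ((p : ℕ) : 𝓞 ℚ) ∉ v.asIdeal →
      W.HasGoodReductionAt v)
    (D : W.SelmerDualData κ γ) [Module.Finite (IwasawaAlgebra p) D.X] (hX : D.IsTorsion)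
    (hμ : D.mu = 0) (hram : ¬ LineUnramifiedAt W p Φ₀) (heven : LineEven W p Φ₀)
    (hlift : ∀ s ∈ ResidualDevissageSelmer.quotSelmer κ.kerSubgroup
        (ResidualDevissageLine.lineSub Φ₀ hΦ).Quot p (↑S₀ : Set (HeightOneSpectrum (𝓞 ℚ))),
      ∃ x ∈ GreenbergVatsal2000.unramifiedOutside κ.kerSubgroup
          ↥((↥(W.geomPrimaryTorsion p))[(p : ℤ)]) p (↑S₀ : Set (HeightOneSpectrum (𝓞 ℚ))),
        ResidualDevissageSelmer.subH1 κ.kerSubgroup (ResidualDevissageLine.lineSub Φ₀ hΦ).proj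
          (ResidualDevissageLine.lineSub Φ₀ hΦ).proj_smul x = s)
    {lφ lψ : ℕ}
    (hφ : Nat.card (GreenbergVatsal2000.unramifiedOutside κ.kerSubgroup
        (ResidualDevissageLine.lineSub Φ₀ hΦ).Sub p (↑S₀ : Set (HeightOneSpectrum (𝓞 ℚ)))) = p ^ lφ)
    (hψ : Nat.card (ResidualDevissageSelmer.quotSelmer κ.kerSubgroup
        (ResidualDevissageLine.lineSub Φ₀ hΦ).Quot p (↑S₀ : Set (HeightOneSpectrum (𝓞 ℚ)))) = p ^ lψ) :
    lφ + lψ = lambdaInvariant p D.X + ∑ v ∈ S₀, delta W p v := by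
  have h := natCard_line_mul_quotSelmer_eq_of_not_split W p κ S₀ hΦ hT hA hB hκ hγ hp2 hmult hns hS₀
    hS D hX hμ hram heven hlift
  rw [hφ, hψ, ← pow_add] at h
  exact pow_right_injective_prime h

end Counts

/-! ## §2. (A)+(B)+(C)+(D): the `λ`/`μ^anal` clause of the flag for THE primitive `p`-adic `L`-function -/

section Assembly

variable (W : WeierstrassCurve ℚ) [W.IsGloballyMinimal] [W.IsElliptic] (p : ℕ) [hp : Fact p.Prime]
  (κ : ZpExtension ℚ p) {γ : absoluteGaloisGroup ℚ} (S₀ : Finset (HeightOneSpectrum (𝓞 ℚ)))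
  {Φ₀ : AddSubgroup (W.geomTorsion (p : ℤ))} (hΦ : IsRationalLine W p Φ₀)

/-- **SPLIT odd `p ‖ N`, GV case 1 — the flag's clause ASSEMBLED.** Inputs: the registered
algebraic facts (A40+A41 `hT`/`hT'`, A133 `hA`, A135 `hB`, A137 `hF`), `κ` cyclotomic with
topological generator `γ`, `Σ₀ ∌ p` finite with every bad prime `≠ p` inside, a dual datum `D` of
`Sel_{p^∞}(E/ℚ_∞)` with `X` f.g. torsion and `μ(X) = 0` (Greenberg 1999 Prop. 5.10 under (GV)), the
rational line `Φ₀` ramified at `p` and even, the lifting property `hlift` (`H²(ℚ_Σ/ℚ_∞, Φ) = 0`);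
the character-theoretic exponents `lφ`, `lψ` (B); and the analytic statement (C) for the
NON-PRIMITIVE element `b · ∏_{ℓ∈Σ₀} 𝒫_ℓ` (`= ϖ·L_{Σ₀}(E/ℚ,T)` under `ι`): unit content and
`ord_T = lφ + lψ`. Output: `b` has unit content and `ord_T(b mod p) = ord_T(T · f_E mod p)` — the
split clause of `lambda_muAnal_multiplicative_of_gvPar`, for any generator `f_E` of `char_Λ X`. -/
theorem unitContent_and_order_eq_of_counts_of_split
    (hT : Silverman1994_thmV53_tateUniformisation.{0})
    (hT' : Silverman1994_thmV53_corV54_tateUniformisation.{0})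
    (hA : lambda_nonPrimitive_eq_add_sum_delta_multiplicative)
    (hB : datumSelmer_divisible_of_finite_torsionBy)
    (hF : datumStrictSelmer_lt_datumSelmer_of_split)
    (hκ : κ.IsCyclotomic) (hγ : κ.IsTopGenerator γ) (hp2 : p ≠ 2)
    (hsplit : W.HasSplitMultiplicativeReductionAtPrime p)
    (hS₀ : ∀ v ∈ S₀, ((p : ℕ) : 𝓞 ℚ) ∉ v.asIdeal)
    (hS : ∀ v : HeightOneSpectrum (𝓞 ℚ), v ∉ S₀ → ((p : ℕ) : 𝓞 ℚ) ∉ v.asIdeal →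
      W.HasGoodReductionAt v)
    (D : W.SelmerDualData κ γ) [Module.Finite (IwasawaAlgebra p) D.X] (hX : D.IsTorsion)
    (hμ : D.mu = 0) (hram : ¬ LineUnramifiedAt W p Φ₀) (heven : LineEven W p Φ₀)
    (hlift : ∀ s ∈ ResidualDevissageSelmer.quotSelmer κ.kerSubgroup
        (ResidualDevissageLine.lineSub Φ₀ hΦ).Quot p (↑S₀ : Set (HeightOneSpectrum (𝓞 ℚ))),
      ∃ x ∈ GreenbergVatsal2000.unramifiedOutside κ.kerSubgroup
          ↥((↥(W.geomPrimaryTorsion p))[(p : ℤ)]) p (↑S₀ : Set (HeightOneSpectrum (𝓞 ℚ))),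
        ResidualDevissageSelmer.subH1 κ.kerSubgroup (ResidualDevissageLine.lineSub Φ₀ hΦ).proj
          (ResidualDevissageLine.lineSub Φ₀ hΦ).proj_smul x = s)
    {lφ lψ : ℕ}
    (hφ : Nat.card (GreenbergVatsal2000.unramifiedOutside κ.kerSubgroup
        (ResidualDevissageLine.lineSub Φ₀ hΦ).Sub p (↑S₀ : Set (HeightOneSpectrum (𝓞 ℚ)))) = p ^ lφ)
    (hψ : Nat.card (ResidualDevissageSelmer.quotSelmer κ.kerSubgroup
        (ResidualDevissageLine.lineSub Φ₀ hΦ).Quot p (↑S₀ : Set (HeightOneSpectrum (𝓞 ℚ)))) = p ^ lψ)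
    {b : IwasawaAlgebra p}
    (hbS : HasUnitContent (b * eulerFactorProduct W p S₀) ∧
      (PowerSeries.map (PadicInt.toZMod (p := p)) (b * eulerFactorProduct W p S₀)).order =
        ((lφ + lψ : ℕ) : ℕ∞))
    {fE : IwasawaAlgebra p} (hchar : D.charIdeal = Ideal.span {fE}) :
    HasUnitContent b ∧
      (PowerSeries.map (PadicInt.toZMod (p := p)) b).order =
        (PowerSeries.map (PadicInt.toZMod (p := p)) (PowerSeries.X * fE)).order := by
  have hS₀' : ∀ v ∈ S₀, Rat.HeightOneSpectrum.natGenerator v ≠ p :=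
    fun v hv => natGenerator_ne_of_natCast_not_mem v (hS₀ v hv)
  have hsum := add_eq_lambdaInvariant_add_of_counts_of_split W p κ S₀ hΦ hT hT' hA hB hF hκ hγ hp2
    hsplit hS₀ hS D hX hμ hram heven hlift hφ hψ
  rw [hsum] at hbS
  rw [order_map_toZMod_X_mul]
  exact unitContent_and_order_eq_of_order_nonPrimitive_eq W S₀ hp2 hS₀' D hX hμ hchar 1 hbS.1 hbS.2

/-- **SPLIT odd `p ‖ N`, GV case 1 — ONE displayed hypothesis.** Same as
`unitContent_and_order_eq_of_counts_of_split` with (B)+(C) merged into the single statement the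
successor's reading-fact should print (GV Thm. (3.11) + (28) + pp. 28–29, 43: "the `λ`-invariant of
`L(G, T)` is equal to `λ_{φ,Σ₀} + λ_{ψ,Σ₀}`. The two terms are the `O`-coranks of `S^{Σ₀}_C(ℚ_∞)` and
`S^{Σ₀}_D(ℚ_∞)`" = the residual dimensions of pp. 28–29): `b^{Σ₀}` has unit content and
`p^{ord_T(b^{Σ₀} mod p)} = #H¹(ℚ_Σ/ℚ_∞, Φ₀) · #S^{Σ₀}_{E[p]/Φ₀}(ℚ_∞)`. -/
theorem unitContent_and_order_eq_of_card_eq_of_split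
    (hT : Silverman1994_thmV53_tateUniformisation.{0})
    (hT' : Silverman1994_thmV53_corV54_tateUniformisation.{0})
    (hA : lambda_nonPrimitive_eq_add_sum_delta_multiplicative)
    (hB : datumSelmer_divisible_of_finite_torsionBy)
    (hF : datumStrictSelmer_lt_datumSelmer_of_split)
    (hκ : κ.IsCyclotomic) (hγ : κ.IsTopGenerator γ) (hp2 : p ≠ 2)
    (hsplit : W.HasSplitMultiplicativeReductionAtPrime p)
    (hS₀ : ∀ v ∈ S₀, ((p : ℕ) : 𝓞 ℚ) ∉ v.asIdeal)
    (hS : ∀ v : HeightOneSpectrum (𝓞 ℚ), v ∉ S₀ → ((p : ℕ) : 𝓞 ℚ) ∉ v.asIdeal →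
      W.HasGoodReductionAt v)
    (D : W.SelmerDualData κ γ) [Module.Finite (IwasawaAlgebra p) D.X] (hX : D.IsTorsion)
    (hμ : D.mu = 0) (hram : ¬ LineUnramifiedAt W p Φ₀) (heven : LineEven W p Φ₀)
    (hlift : ∀ s ∈ ResidualDevissageSelmer.quotSelmer κ.kerSubgroup
        (ResidualDevissageLine.lineSub Φ₀ hΦ).Quot p (↑S₀ : Set (HeightOneSpectrum (𝓞 ℚ))),
      ∃ x ∈ GreenbergVatsal2000.unramifiedOutside κ.kerSubgroup
          ↥((↥(W.geomPrimaryTorsion p))[(p : ℤ)]) p (↑S₀ : Set (HeightOneSpectrum (𝓞 ℚ))),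
        ResidualDevissageSelmer.subH1 κ.kerSubgroup (ResidualDevissageLine.lineSub Φ₀ hΦ).proj
          (ResidualDevissageLine.lineSub Φ₀ hΦ).proj_smul x = s)
    {b : IwasawaAlgebra p}
    (hC : HasUnitContent (b * eulerFactorProduct W p S₀) ∧
      p ^ (PowerSeries.map (PadicInt.toZMod (p := p)) (b * eulerFactorProduct W p S₀)).order.toNat =
        Nat.card (GreenbergVatsal2000.unramifiedOutside κ.kerSubgroup
            (ResidualDevissageLine.lineSub Φ₀ hΦ).Sub p (↑S₀ : Set (HeightOneSpectrum (𝓞 ℚ)))) *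
          Nat.card (ResidualDevissageSelmer.quotSelmer κ.kerSubgroup
            (ResidualDevissageLine.lineSub Φ₀ hΦ).Quot p (↑S₀ : Set (HeightOneSpectrum (𝓞 ℚ)))))
    {fE : IwasawaAlgebra p} (hchar : D.charIdeal = Ideal.span {fE}) :
    HasUnitContent b ∧
      (PowerSeries.map (PadicInt.toZMod (p := p)) b).order =
        (PowerSeries.map (PadicInt.toZMod (p := p)) (PowerSeries.X * fE)).order := by
  have hS₀' : ∀ v ∈ S₀, Rat.HeightOneSpectrum.natGenerator v ≠ p :=
    fun v hv => natGenerator_ne_of_natCast_not_mem v (hS₀ v hv)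
  obtain ⟨hbu, hC⟩ := hC
  have hA' := natCard_line_mul_quotSelmer_eq_of_split W p κ S₀ hΦ hT hT' hA hB hF hκ hγ hp2 hsplit hS₀
    hS D hX hμ hram heven hlift
  rw [hA'] at hC
  have hexp := pow_right_injective_prime (p := p) hC
  have hfin : (PowerSeries.map (PadicInt.toZMod (p := p)) (b * eulerFactorProduct W p S₀)).order ≠ ⊤ := by
    rw [Ne, PowerSeries.order_eq_top]
    exact (hasUnitContent_iff_map_toZMod_ne_zero _).mp hbu
  have hord : (PowerSeries.map (PadicInt.toZMod (p := p)) (b * eulerFactorProduct W p S₀)).order =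
      ((lambdaInvariant p D.X + ∑ v ∈ S₀, delta W p v + 1 : ℕ) : ℕ∞) := by
    rw [← hexp, ENat.coe_toNat hfin]
  rw [order_map_toZMod_X_mul]
  exact unitContent_and_order_eq_of_order_nonPrimitive_eq W S₀ hp2 hS₀' D hX hμ hchar 1 hbu hord

/-- **NON-SPLIT odd `p ‖ N`, GV case 1 — the flag's clause ASSEMBLED** (no trivial zero: the
conclusion is `ord_T(b mod p) = ord_T(f_E mod p)`; inputs as in the split case without A40/A137). -/
theorem unitContent_and_order_eq_of_counts_of_not_split
    (hT : Silverman1994_thmV53_corV54_tateUniformisation.{0})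
    (hA : lambda_nonPrimitive_eq_add_sum_delta_multiplicative)
    (hB : datumSelmer_divisible_of_finite_torsionBy)
    (hκ : κ.IsCyclotomic) (hγ : κ.IsTopGenerator γ) (hp2 : p ≠ 2)
    (hmult : W.HasMultiplicativeReductionAtPrime p) (hns : ¬ W.HasSplitMultiplicativeReductionAtPrime p)
    (hS₀ : ∀ v ∈ S₀, ((p : ℕ) : 𝓞 ℚ) ∉ v.asIdeal)
    (hS : ∀ v : HeightOneSpectrum (𝓞 ℚ), v ∉ S₀ → ((p : ℕ) : 𝓞 ℚ) ∉ v.asIdeal →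
      W.HasGoodReductionAt v)
    (D : W.SelmerDualData κ γ) [Module.Finite (IwasawaAlgebra p) D.X] (hX : D.IsTorsion)
    (hμ : D.mu = 0) (hram : ¬ LineUnramifiedAt W p Φ₀) (heven : LineEven W p Φ₀)
    (hlift : ∀ s ∈ ResidualDevissageSelmer.quotSelmer κ.kerSubgroup
        (ResidualDevissageLine.lineSub Φ₀ hΦ).Quot p (↑S₀ : Set (HeightOneSpectrum (𝓞 ℚ))),
      ∃ x ∈ GreenbergVatsal2000.unramifiedOutside κ.kerSubgroup
          ↥((↥(W.geomPrimaryTorsion p))[(p : ℤ)]) p (↑S₀ : Set (HeightOneSpectrum (𝓞 ℚ))),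
        ResidualDevissageSelmer.subH1 κ.kerSubgroup (ResidualDevissageLine.lineSub Φ₀ hΦ).proj
          (ResidualDevissageLine.lineSub Φ₀ hΦ).proj_smul x = s)
    {lφ lψ : ℕ}
    (hφ : Nat.card (GreenbergVatsal2000.unramifiedOutside κ.kerSubgroup
        (ResidualDevissageLine.lineSub Φ₀ hΦ).Sub p (↑S₀ : Set (HeightOneSpectrum (𝓞 ℚ)))) = p ^ lφ)
    (hψ : Nat.card (ResidualDevissageSelmer.quotSelmer κ.kerSubgroup
        (ResidualDevissageLine.lineSub Φ₀ hΦ).Quot p (↑S₀ : Set (HeightOneSpectrum (𝓞 ℚ)))) = p ^ lψ)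
    {b : IwasawaAlgebra p}
    (hbS : HasUnitContent (b * eulerFactorProduct W p S₀) ∧
      (PowerSeries.map (PadicInt.toZMod (p := p)) (b * eulerFactorProduct W p S₀)).order =
        ((lφ + lψ : ℕ) : ℕ∞))
    {fE : IwasawaAlgebra p} (hchar : D.charIdeal = Ideal.span {fE}) :
    HasUnitContent b ∧
      (PowerSeries.map (PadicInt.toZMod (p := p)) b).order =
        (PowerSeries.map (PadicInt.toZMod (p := p)) fE).order := by
  have hS₀' : ∀ v ∈ S₀, Rat.HeightOneSpectrum.natGenerator v ≠ p :=
    fun v hv => natGenerator_ne_of_natCast_not_mem v (hS₀ v hv)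
  have hsum := add_eq_lambdaInvariant_add_of_counts_of_not_split W p κ S₀ hΦ hT hA hB hκ hγ hp2
    hmult hns hS₀ hS D hX hμ hram heven hlift hφ hψ
  rw [hsum] at hbS
  have h := unitContent_and_order_eq_of_order_nonPrimitive_eq W S₀ hp2 hS₀' D hX hμ hchar 0 hbS.1
    (by rw [hbS.2, add_zero])
  rwa [Nat.cast_zero, add_zero] at h

/-- **NON-SPLIT odd `p ‖ N`, GV case 1 — ONE displayed hypothesis** (as in the split case). -/
theorem unitContent_and_order_eq_of_card_eq_of_not_split
    (hT : Silverman1994_thmV53_corV54_tateUniformisation.{0})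
    (hA : lambda_nonPrimitive_eq_add_sum_delta_multiplicative)
    (hB : datumSelmer_divisible_of_finite_torsionBy)
    (hκ : κ.IsCyclotomic) (hγ : κ.IsTopGenerator γ) (hp2 : p ≠ 2)
    (hmult : W.HasMultiplicativeReductionAtPrime p) (hns : ¬ W.HasSplitMultiplicativeReductionAtPrime p)
    (hS₀ : ∀ v ∈ S₀, ((p : ℕ) : 𝓞 ℚ) ∉ v.asIdeal)
    (hS : ∀ v : HeightOneSpectrum (𝓞 ℚ), v ∉ S₀ → ((p : ℕ) : 𝓞 ℚ) ∉ v.asIdeal →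
      W.HasGoodReductionAt v)
    (D : W.SelmerDualData κ γ) [Module.Finite (IwasawaAlgebra p) D.X] (hX : D.IsTorsion)
    (hμ : D.mu = 0) (hram : ¬ LineUnramifiedAt W p Φ₀) (heven : LineEven W p Φ₀)
    (hlift : ∀ s ∈ ResidualDevissageSelmer.quotSelmer κ.kerSubgroup
        (ResidualDevissageLine.lineSub Φ₀ hΦ).Quot p (↑S₀ : Set (HeightOneSpectrum (𝓞 ℚ))),
      ∃ x ∈ GreenbergVatsal2000.unramifiedOutside κ.kerSubgroup
          ↥((↥(W.geomPrimaryTorsion p))[(p : ℤ)]) p (↑S₀ : Set (HeightOneSpectrum (𝓞 ℚ))),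
        ResidualDevissageSelmer.subH1 κ.kerSubgroup (ResidualDevissageLine.lineSub Φ₀ hΦ).proj
          (ResidualDevissageLine.lineSub Φ₀ hΦ).proj_smul x = s)
    {b : IwasawaAlgebra p}
    (hC : HasUnitContent (b * eulerFactorProduct W p S₀) ∧
      p ^ (PowerSeries.map (PadicInt.toZMod (p := p)) (b * eulerFactorProduct W p S₀)).order.toNat =
        Nat.card (GreenbergVatsal2000.unramifiedOutside κ.kerSubgroup
            (ResidualDevissageLine.lineSub Φ₀ hΦ).Sub p (↑S₀ : Set (HeightOneSpectrum (𝓞 ℚ)))) *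
          Nat.card (ResidualDevissageSelmer.quotSelmer κ.kerSubgroup
            (ResidualDevissageLine.lineSub Φ₀ hΦ).Quot p (↑S₀ : Set (HeightOneSpectrum (𝓞 ℚ)))))
    {fE : IwasawaAlgebra p} (hchar : D.charIdeal = Ideal.span {fE}) :
    HasUnitContent b ∧
      (PowerSeries.map (PadicInt.toZMod (p := p)) b).order =
        (PowerSeries.map (PadicInt.toZMod (p := p)) fE).order := by
  have hS₀' : ∀ v ∈ S₀, Rat.HeightOneSpectrum.natGenerator v ≠ p :=
    fun v hv => natGenerator_ne_of_natCast_not_mem v (hS₀ v hv)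
  obtain ⟨hbu, hC⟩ := hC
  have hA' := natCard_line_mul_quotSelmer_eq_of_not_split W p κ S₀ hΦ hT hA hB hκ hγ hp2 hmult hns hS₀
    hS D hX hμ hram heven hlift
  rw [hA'] at hC
  have hexp := pow_right_injective_prime (p := p) hC
  have hfin : (PowerSeries.map (PadicInt.toZMod (p := p)) (b * eulerFactorProduct W p S₀)).order ≠ ⊤ := by
    rw [Ne, PowerSeries.order_eq_top]
    exact (hasUnitContent_iff_map_toZMod_ne_zero _).mp hbu
  have hord : (PowerSeries.map (PadicInt.toZMod (p := p)) (b * eulerFactorProduct W p S₀)).order =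
      ((lambdaInvariant p D.X + ∑ v ∈ S₀, delta W p v + 0 : ℕ) : ℕ∞) := by
    rw [add_zero, ← hexp, ENat.coe_toNat hfin]
  have h := unitContent_and_order_eq_of_order_nonPrimitive_eq W S₀ hp2 hS₀' D hX hμ hchar 0 hbu hord
  rwa [Nat.cast_zero, add_zero] at h

end Assembly

end Summit.BirchSwinnertonDyer.Rank1Residual.X2.GreenbergVatsalAnalyticTransfer

end
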